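import Summits.HodgeConjecture.HodgeConjecture.Theorems.F0P3cStCharTSCayleyChartHaar   -- ★ (C4) p851851: `map_restrict_chart_eq_smul_haar`, `measure_chart_image_eq`, level ∕ chart kit
import Literature.NumberTheory.Weil1982.CayleyWindowCentralizerData                    -- ★ (Q3) p851861 (LH3-p04): `cayley_unitary_comm_of_valBound`, `cayleySandwich_skew_comm_of_valBound`, `exists_skew_cayley_eq_of_le`
import HarnessLib

/-!
# F0 · P3c · line LH6 «StCharTS» — WIF antecedent, ELLIPTIC half: brick (C4u) «THE CAYLEY CHART OF THE CENTRALISER `Z_{U(J)}(x)` CARRIES HAAR MEASURE» —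
# ★ (C4) instantiated with ★ (Q3): the levels, the chart and the chart product are CONSTRUCTED, and additive Haar measure of the Lie ball is Haar measure on the window

Cell `pub/hodgecm-mathlib`, crux H413 = `stmt-HodgeConjecture-24833` (lane `--supports … --as helper`); seat LH5-p02 (g6); ROAD «JAC-ELL» v1
(`F0/P3c/LH5/LH5-p02/g6/ROAD-JAC-ELL.v1.LH5p02g6.md`) step (1) of the assembly C8b, for BOTH uses: `x = 1` (the group `U(J)(K)` itself) and `x = γ₀`
(the compact Cartan `T = Z_{U(J)}(γ₀)`).  THEOREMS ONLY; Mathlib + ★ (C4) + ★ (Q3).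

SETTING.  `K` a non-archimedean local field with involution-like `σ : K →+* K` (no property of `σ` is used), `J x : Matrix m m K`, radii `0 ≠ α < 1`,
`0 ≠ β < |2|`, `β ≤ |2|·α`.  The group and its Lie algebra enter ABSTRACTLY, by their RANGES (so that `↥(unitaryGroupOfForm σ J)`, a Cartan
`↥(Subgroup.centralizer {γ₀})` inside it, or any other model are instances without subtype juggling):
* `ρ : G →* GL m K` injective, inducing, with `range ρ = {g | ᵗ(σg)·J·g = J ∧ g·x = x·g}`;
* `ι : V →+ Matrix m m K` a closed embedding with `range ι = {X | ᵗ(σX)·J + J·X = 0 ∧ X·x = x·X}`;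
* `μ` an additive Haar measure on `V`, `ν` a Haar measure on `G`.

THE RESULT `exists_cayley_chart_haar` (all PROVED): there are levels `Λ j = ι⁻¹{ValBound α^(j+1)}` (as `AddSubgroup V`), a chart `c : V → G` with `ρ (c X) = cayley (ι X)` on
`Λ 0`, and a chart product `σV` with `ι (σV W X) = S(ι W, ι X)` on `Λ 0 × Λ 0` (★ Q3: the sandwich is skew and commutes with `x`), continuous in `X`, such that the
inverse window holds (`ValBound β (ρ g − 1) → g ∈ c '' Λ 0`, ★ Q3) and therefore, by ★ (C4),
**`(μ.restrict (Λ 0)).map c = (μ (Λ 0) ∕ ν (c '' Λ 0)) • ν.restrict (c '' Λ 0)`** and **`μ A = (μ (Λ 0) ∕ ν (c '' Λ 0)) · ν (c '' A)`** for `A ⊆ Λ 0` with Borel image.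

HONEST LABEL: HC_CM is proved only modulo the 7 printed citations (2 remaining named inputs: hLiu418 = `stmt-HodgeConjecture-24832`, h413 =
`stmt-HodgeConjecture-24833`) until rung 0 closes; this file closes no organ (count-neutral bank for the elliptic half of the WIF antecedent of RUNG0).

## References
* [Serre1992LALG] J.-P. Serre, *Lie Algebras and Lie Groups*, LNM 1500 (1992), Part II Ch. IV §8–§9. Context locator.
* [PlatonovRapinchuk1994] V. Platonov, A. Rapinchuk, *Algebraic Groups and Number Theory* (1994), §3.3. Context locator.
* [Helgason2000] S. Helgason, *Groups and Geometric Analysis* (2000), Ch. I §1 Thm. 1.14 (13) p. 96. Context locator.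
-/

set_option autoImplicit false
set_option linter.dupNamespace false

open Set Filter MeasureTheory MeasureTheory.Measure TopologicalSpace Topology Matrix ValuativeRel
open Literature.NumberTheory.Automorphic Literature.NumberTheory.Weil1982.UnitaryFinTopForm
open Summit.HodgeConjecture.HodgeConjecture.Cruxes.H413.F0P3cStCharTSCayleyChartHaar
open scoped Pointwise Topology ENNReal MatrixGroups

namespace Summit.HodgeConjecture.HodgeConjecture.Cruxes.H413.F0P3cStCharTSCayleyChartUnitary

section Data

variable {K : Type*} [Field K] [ValuativeRel K] {m : Type*} [Fintype m] [DecidableEq m]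
  {V : Type*} [AddCommGroup V] {G : Type*} [Group G]
  (σ : K →+* K) (J x : Matrix m m K) (ι : V →+ Matrix m m K) (ρ : G →* GL m K) {α : ValueGroupWithZero K}

omit [Fintype m] [DecidableEq m] [Group G] in
/-- The levels `ι⁻¹ {ValBound γ}` are additive subgroups (construction inside a proof; no definition is introduced). [cite: Serre1992LALG, Part II Ch. IV §9] -/
theorem exists_levels (α : ValueGroupWithZero K) :
    ∃ Λ : ℕ → AddSubgroup V, ∀ j X, X ∈ Λ j ↔ ValBound (α ^ (j + 1)) (ι X) := by
  refine ⟨fun j => { carrier := {X | ValBound (α ^ (j + 1)) (ι X)}, add_mem' := ?_, zero_mem' := ?_, neg_mem' := ?_ },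
    fun j X => Iff.rfl⟩
  · intro a b ha hb
    simp only [Set.mem_setOf_eq, map_add] at ha hb ⊢
    exact ha.add hb
  · simp only [Set.mem_setOf_eq, map_zero]
    exact valBound_zero _
  · intro a ha
    simp only [Set.mem_setOf_eq, map_neg] at ha ⊢
    exact ha.neg

/-- **The chart exists**: for `X ∈ Λ 0` the matrix `cayley (ι X)` is `σ`-unitary for `J` and commutes with `x` (★ Q3), hence is `ρ` of a (unique) element of `G`.
[cite: PlatonovRapinchuk1994, §3.3] -/
theorem exists_chart {Λ : ℕ → AddSubgroup V} (hΛ : ∀ j X, X ∈ Λ j ↔ ValBound (α ^ (j + 1)) (ι X)) (hα1 : α < 1)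
    (hιr : ∀ X, X ∈ Set.range ι ↔ ((X.map σ)ᵀ * J + J * X = 0 ∧ X * x = x * X))
    (hρr : ∀ g : GL m K, g ∈ Set.range ρ ↔ ((((g : Matrix m m K)).map σ)ᵀ * J * (g : Matrix m m K) = J ∧ (g : Matrix m m K) * x = x * (g : Matrix m m K))) :
    ∃ c : V → G, ∀ X ∈ Λ 0, ((ρ (c X) : GL m K) : Matrix m m K) = cayley (ι X) := by
  classical
  have key : ∀ X ∈ Λ 0, ∃ g : G, ((ρ g : GL m K) : Matrix m m K) = cayley (ι X) := by
    intro X hX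
    have hXb : ValBound α (ι X) := valBound_of_mem_level_zero ι Λ hΛ hX
    obtain ⟨hXs, hXx⟩ := (hιr (ι X)).1 ⟨X, rfl⟩
    obtain ⟨hU, hcomm⟩ := cayley_unitary_comm_of_valBound σ (J := J) (x := x) hXb hα1 hXs hXx
    obtain ⟨hm', -, -⟩ := isUnit_det_one_sub_of_valBound hXb hα1
    obtain ⟨hp', -, -⟩ := isUnit_det_one_add_of_valBound hXb hα1
    obtain ⟨g, hg⟩ := (hρr (cayleyGL (ι X) hm' hp')).2 ⟨by simpa [coe_cayleyGL] using hU, by simpa [coe_cayleyGL] using hcomm⟩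
    exact ⟨g, by rw [hg, coe_cayleyGL]⟩
  refine ⟨fun X => if h : X ∈ Λ 0 then (key X h).choose else 1, fun X hX => ?_⟩
  simp only [dif_pos hX]
  exact (key X hX).choose_spec

/-- **The chart product exists**: for `W, X ∈ Λ 0` the sandwich `S(ι W, ι X)` is again skew and commutes with `x` (★ Q3), hence is `ι` of a (unique) element of `V`.
[cite: Serre1992LALG, Part II Ch. IV §8] -/
theorem exists_chartProduct {Λ : ℕ → AddSubgroup V} (hΛ : ∀ j X, X ∈ Λ j ↔ ValBound (α ^ (j + 1)) (ι X)) (hα1 : α < 1) (h2 : (2 : K) ≠ 0)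
    (hιr : ∀ X, X ∈ Set.range ι ↔ ((X.map σ)ᵀ * J + J * X = 0 ∧ X * x = x * X)) :
    ∃ σV : V → V → V, ∀ W ∈ Λ 0, ∀ X ∈ Λ 0,
      ι (σV W X) = (1 - ι W)⁻¹ * (ι W + ι X) * (1 + ι W * ι X)⁻¹ * (1 - ι W) := by
  classical
  have key : ∀ W ∈ Λ 0, ∀ X ∈ Λ 0, ∃ Z : V, ι Z = (1 - ι W)⁻¹ * (ι W + ι X) * (1 + ι W * ι X)⁻¹ * (1 - ι W) := by
    intro W hW X hX
    have hWb : ValBound α (ι W) := valBound_of_mem_level_zero ι Λ hΛ hW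
    have hXb : ValBound α (ι X) := valBound_of_mem_level_zero ι Λ hΛ hX
    obtain ⟨hWs, hWx⟩ := (hιr (ι W)).1 ⟨W, rfl⟩
    obtain ⟨hXs, hXx⟩ := (hιr (ι X)).1 ⟨X, rfl⟩
    obtain ⟨hS, hSx⟩ := cayleySandwich_skew_comm_of_valBound σ h2 (J := J) (x := x) hWb hXb hα1 hWs hXs hWx hXx
    obtain ⟨Z, hZ⟩ := (hιr _).2 ⟨hS, hSx⟩
    exact ⟨Z, hZ⟩
  refine ⟨fun W X => if h : W ∈ Λ 0 ∧ X ∈ Λ 0 then (key W h.1 X h.2).choose else 0, fun W hW X hX => ?_⟩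
  simp only [dif_pos (And.intro hW hX)]
  exact (key W hW X hX).choose_spec

end Data

section Topology

variable {K : Type*} [Field K] [ValuativeRel K] [TopologicalSpace K] [IsNonarchimedeanLocalField K]
  {m : Type*} [Fintype m] [DecidableEq m]
  {V : Type*} [AddCommGroup V] [TopologicalSpace V] {G : Type*} [Group G]
  (σ : K →+* K) (J x : Matrix m m K) (ι : V →+ Matrix m m K) (ρ : G →* GL m K) {α : ValueGroupWithZero K}

/-- The matrix-level sandwich `X ↦ S(W₀, ι X)` is continuous on the base box (matrix inversion is continuous at unit determinant). [cite: PlatonovRapinchuk1994, §3.3] -/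
theorem continuousOn_sandwich_comp (hι : Continuous ι) {Λ : ℕ → AddSubgroup V} (hΛ : ∀ j X, X ∈ Λ j ↔ ValBound (α ^ (j + 1)) (ι X)) (hα1 : α < 1)
    {W₀ : Matrix m m K} (hW₀ : ValBound α W₀) :
    ContinuousOn (fun X : V => (1 - W₀)⁻¹ * (W₀ + ι X) * (1 + W₀ * ι X)⁻¹ * (1 - W₀)) (Λ 0 : Set V) := by
  intro X hX
  have hXb : ValBound α (ι X) := valBound_of_mem_level_zero ι Λ hΛ hX
  obtain ⟨hBu, -, -⟩ := isUnit_det_one_add_mul_of_valBound hW₀ hXb hα1 hα1.le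
  have hlin : Continuous fun X : V => 1 + W₀ * ι X := continuous_const.add (continuous_const.mul hι)
  have hinv : ContinuousAt Inv.inv (1 + W₀ * ι X) := by
    refine continuousAt_matrix_inv _ ?_
    rw [Ring.inverse_eq_inv']
    exact continuousAt_inv₀ hBu.ne_zero
  have h1 : ContinuousAt (fun X : V => (1 + W₀ * ι X)⁻¹) X := ContinuousAt.comp (g := Inv.inv) (f := fun X : V => 1 + W₀ * ι X) hinv hlin.continuousAt
  exact (((continuous_const.mul (continuous_const.add hι)).continuousAt.mul h1).mul continuous_const.continuousAt).continuousWithinAt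

/-- **The chart product is continuous in its second argument on the base box** (`ι` is an embedding). [cite: Serre1992LALG, Part II Ch. IV §8] -/
theorem continuousOn_chartProduct (hι : IsClosedEmbedding ι) {Λ : ℕ → AddSubgroup V} (hΛ : ∀ j X, X ∈ Λ j ↔ ValBound (α ^ (j + 1)) (ι X)) (hα1 : α < 1)
    {σV : V → V → V} (hσ : ∀ W ∈ Λ 0, ∀ X ∈ Λ 0, ι (σV W X) = (1 - ι W)⁻¹ * (ι W + ι X) * (1 + ι W * ι X)⁻¹ * (1 - ι W)) :
    ∀ W ∈ Λ 0, ContinuousOn (σV W) (Λ 0 : Set V) := by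
  intro W hW
  rw [hι.isInducing.continuousOn_iff]
  refine (continuousOn_sandwich_comp ι hι.continuous hΛ hα1 (valBound_of_mem_level_zero ι Λ hΛ hW)).congr fun X hX => ?_
  simp only [Function.comp_apply]
  exact hσ W hW X hX

omit [TopologicalSpace K] [IsNonarchimedeanLocalField K] [TopologicalSpace V] in
/-- **The inverse window** (hypothesis `hwin` of ★ (C4)): an element of `G` with `ρ g ≡ 1` within `β` (`β < |2|`, `β ≤ |2|·α`) lies in the window `c '' Λ 0`
(★ Q3 `exists_skew_cayley_eq_of_le` + injectivity of `ρ`). [cite: PlatonovRapinchuk1994, §3.3] -/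
theorem chart_window {Λ : ℕ → AddSubgroup V} (hΛ : ∀ j X, X ∈ Λ j ↔ ValBound (α ^ (j + 1)) (ι X)) (hρinj : Function.Injective ρ)
    (hιr : ∀ X, X ∈ Set.range ι ↔ ((X.map σ)ᵀ * J + J * X = 0 ∧ X * x = x * X))
    (hρr : ∀ g : GL m K, g ∈ Set.range ρ ↔ ((((g : Matrix m m K)).map σ)ᵀ * J * (g : Matrix m m K) = J ∧ (g : Matrix m m K) * x = x * (g : Matrix m m K)))
    {c : V → G} (hc : ∀ X ∈ Λ 0, ((ρ (c X) : GL m K) : Matrix m m K) = cayley (ι X))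
    {β : ValueGroupWithZero K} (hβ : β < valuation K 2) (hβα : β ≤ valuation K 2 * α) :
    ∀ g : G, ValBound β (((ρ g : GL m K) : Matrix m m K) - 1) → g ∈ c '' (Λ 0 : Set V) := by
  intro g hg
  obtain ⟨hU, hgx⟩ := (hρr (ρ g)).1 ⟨g, rfl⟩
  obtain ⟨X, hXs, hXx, hXb, -, hcay⟩ := exists_skew_cayley_eq_of_le σ hU hgx hg hβ hβα
  obtain ⟨X', rfl⟩ := (hιr X).2 ⟨hXs, hXx⟩
  have hX' : X' ∈ Λ 0 := by rw [hΛ, zero_add, pow_one]; exact hXb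
  refine ⟨X', hX', hρinj (Units.ext ?_)⟩
  rw [hc X' hX', hcay]

end Topology

/-! ## The chart carries Haar measure -/

section Haar

variable {K : Type*} [Field K] [ValuativeRel K] [TopologicalSpace K] [IsNonarchimedeanLocalField K]
  {m : Type*} [Fintype m] [DecidableEq m]
  {V : Type*} [AddCommGroup V] [TopologicalSpace V] [IsTopologicalAddGroup V] [T2Space V] [SecondCountableTopology V]
  [MeasurableSpace V] [BorelSpace V]
  {G : Type*} [Group G] [TopologicalSpace G] [IsTopologicalGroup G] [LocallyCompactSpace G] [SecondCountableTopology G] [T2Space G]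
  [MeasurableSpace G] [BorelSpace G]
  (σ : K →+* K) (J x : Matrix m m K) (ι : V →+ Matrix m m K) (ρ : G →* GL m K)
  (μ : Measure V) [μ.IsAddHaarMeasure] (ν : Measure G) [ν.IsHaarMeasure]

/-- **THE CAYLEY CHART OF THE CENTRALISER `Z_{U(J)}(x)` CARRIES HAAR MEASURE.**  Under the range descriptions of `ι` (skew, commuting with `x`) and `ρ`
(unitary, commuting with `x`), for radii `0 ≠ α < 1`, `0 ≠ β < |2|`, `β ≤ |2|·α`: there are levels `Λ`, a chart `c` and a chart product `σV` with the displayed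
properties, and `(μ.restrict (Λ 0)).map c = (μ (Λ 0) ∕ ν (c '' Λ 0)) • ν.restrict (c '' Λ 0)`, `μ A = (μ (Λ 0) ∕ ν (c '' Λ 0)) · ν (c '' A)` (`A ⊆ Λ 0`, Borel image).
[cite: Helgason2000, Ch. I §1 Thm. 1.14 (13) p. 96] [cite: Serre1992LALG, Part II Ch. IV §9] -/
theorem exists_cayley_chart_haar (hι : IsClosedEmbedding ι) (hρ : IsInducing ρ) (hρinj : Function.Injective ρ)
    (hιr : ∀ X, X ∈ Set.range ι ↔ ((X.map σ)ᵀ * J + J * X = 0 ∧ X * x = x * X))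
    (hρr : ∀ g : GL m K, g ∈ Set.range ρ ↔ ((((g : Matrix m m K)).map σ)ᵀ * J * (g : Matrix m m K) = J ∧ (g : Matrix m m K) * x = x * (g : Matrix m m K)))
    {α β : ValueGroupWithZero K} (hα : α ≠ 0) (hα1 : α < 1) (hβ0 : β ≠ 0) (hβ : β < valuation K 2) (hβα : β ≤ valuation K 2 * α) :
    ∃ (Λ : ℕ → AddSubgroup V) (c : V → G) (σV : V → V → V),
      (∀ j X, X ∈ Λ j ↔ ValBound (α ^ (j + 1)) (ι X)) ∧
      (∀ X ∈ Λ 0, ((ρ (c X) : GL m K) : Matrix m m K) = cayley (ι X)) ∧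
      (∀ W ∈ Λ 0, ∀ X ∈ Λ 0, ι (σV W X) = (1 - ι W)⁻¹ * (ι W + ι X) * (1 + ι W * ι X)⁻¹ * (1 - ι W)) ∧
      (∀ W ∈ Λ 0, ContinuousOn (σV W) (Λ 0 : Set V)) ∧
      (∀ g : G, ValBound β (((ρ g : GL m K) : Matrix m m K) - 1) → g ∈ c '' (Λ 0 : Set V)) ∧
      (μ.restrict (Λ 0 : Set V)).map c = (μ (Λ 0 : Set V) / ν (c '' (Λ 0 : Set V))) • ν.restrict (c '' (Λ 0 : Set V)) ∧
      (∀ A ⊆ (Λ 0 : Set V), MeasurableSet (c '' A) → μ A = (μ (Λ 0 : Set V) / ν (c '' (Λ 0 : Set V))) * ν (c '' A)) := by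
  have h2 : (2 : K) ≠ 0 := by
    intro h0
    rw [h0, map_zero] at hβ
    exact not_lt_zero hβ
  obtain ⟨Λ, hΛ⟩ := exists_levels ι α (V := V)
  obtain ⟨c, hc⟩ := exists_chart σ J x ι ρ hΛ hα1 hιr hρr
  obtain ⟨σV, hσ⟩ := exists_chartProduct σ J x ι hΛ hα1 h2 hιr
  have hσc := continuousOn_chartProduct ι hι hΛ hα1 hσ
  have hwin := chart_window σ J x ι ρ hΛ hρinj hιr hρr hc hβ hβα
  exact ⟨Λ, c, σV, hΛ, hc, hσ, hσc, hwin,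
    map_restrict_chart_eq_smul_haar ι Λ ρ c σV μ ν hι hΛ hα hα1 hρ hρinj hc hσ hσc hβ0 hwin,
    fun A hA hAm => measure_chart_image_eq ι Λ ρ c σV μ ν h2 hι hΛ hα hα1 hρ hρinj hc hσ hσc hβ0 hwin hA hAm⟩

end Haar

end Summit.HodgeConjecture.HodgeConjecture.Cruxes.H413.F0P3cStCharTSCayleyChartUnitary
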